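import Summits.KontsevichZagierPeriods.Zeta5Search.Barrier.ConeGammaEnvelopeCert

/-!
# ζ(5) search — BARRIER: THE ENVELOPE BOUND WITHOUT CALCULUS — the first-order theorem for critical values

HONEST FRAMING (cell `pub-zeta5`): systematic search; no irrationality claim unless kernel-certified. Theorems only. MODEL
objects under Brown–Zudilin's (28)+(30) ((28) observed, not proved): BZ's growth functional `growthLogR` at critical points
(`ConeGammaRates.IsCritical`) — i.e. the critical values whose largest / second largest are `C₁` / `C₀` — and cert-2 g39's
checker `Envelope.envSummary / envBoxCheck`. Nothing here identifies WHICH critical value a tube carries (that is the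
business of cert-2 g37/g38's certificates), nothing about any γ, the cone's supremum (C2 OPEN), S-E (CONJECTURED), (TD_A)
or `ζ(5)`; no number of record moves; records in print UNMOVED. Theory seat cert-2 g39 (item «THE ENVELOPE BOUND FOR C₁
WITHOUT CALCULUS», part 3b).

* **`critical_value_first_order`** — for a critical point `(X, Y)` of the box direction `t` and a critical point
  `(X_c, Y_c)` of the CENTRE direction `c`, both in the tube: `∃ v ∈ hull, |growthLogR(t; X, Y) − growthLogR(c; X_c, Y_c)
  − Σ_i (t_i − c_i)·v_i| ≤ e/(SC·Q)` — the first-order Taylor model of a critical value in the direction, the envelope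
  gradient `∂V/∂t` enclosed by the hull, obtained WITHOUT the implicit-function / envelope theorem (secants in `t`, the
  critical equations at the centre, tangent differences in `(X, Y)`);
* `critical_value_box` — `envBoxCheck … p q = true ⇒ |growthLogR(t; X, Y) − growthLogR(c; X_c, Y_c)| ≤ p/q`.
-/

noncomputable section

open Finset Set
open Literature.Analysis.ValidatedNumerics.NumericsMP

namespace Summit.KontsevichZagierPeriods.Zeta5Search.Barrier.ConeGamma

namespace Envelope

open LemmaFBox (SC SC_pos KT coef featVal minNum maxNum sum8 lnNat box centre centre_mem abs_sub_centre_le abs_le_of_mem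
  minNum_le le_maxNum cast_toNat_of_pos getD_map_range featVal_sub_eq_sum sum8_eq_sum mem_log_of_range)
open LemmaFWinBox (getI addHull zeroHull hull_zero hull_addHull getI_addHull boxOK8 boxOK8_spec)
open LemmaFWin (zI mem_zI)

/-! ### The first-order theorem for critical values -/

/-- Unpacking `envOK`. -/
theorem envOK_spec {D T0 : ℕ} {lo hi : List ℕ} {tb : Tube} (h : envOK D T0 lo hi tb = true) :
    0 < D ∧ (0 < T0 / 2 ∧ T0 % 2 = 0) ∧ lo.getD 0 0 = D ∧ hi.getD 0 0 = D ∧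
      (∀ i : Fin 8, lo.getD i 0 ≤ hi.getD i 0 ∧ hi.getD i 0 ≤ D) ∧
      (∀ j : Fin 7, 0 < lo.getD (j.val + 1) 0 ∧ hi.getD (j.val + 1) 0 < D) := by
  unfold envOK at h
  simp only [Bool.and_eq_true, decide_eq_true_eq, List.all_eq_true, List.mem_range] at h
  obtain ⟨⟨⟨⟨⟨hbox, hT⟩, hT2⟩, _⟩, _⟩, hopen⟩ := h
  obtain ⟨hD, h0, h0', hle⟩ := boxOK8_spec hbox
  exact ⟨hD, ⟨hT, hT2⟩, h0, h0', hle, fun j => hopen j j.isLt⟩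

/-- A box direction of an `envOK` box lies in the open box: `0 < t_j < t_0 = 1`. -/
theorem openBox_of_envOK {D T0 : ℕ} {lo hi : List ℕ} {tb : Tube} (h : envOK D T0 lo hi tb = true)
    {t : Fin 8 → ℝ} (ht : t ∈ box D lo hi) : t 0 = 1 ∧ ∀ j : Fin 7, 0 < t j.succ ∧ t j.succ < t 0 := by
  obtain ⟨hD, _, h0, h0', _, hopen⟩ := envOK_spec h
  have hD' : (0 : ℝ) < D := by exact_mod_cast hD
  have ht0 : t 0 = 1 := by
    have a : ((lo.getD 0 0 : ℕ) : ℝ) ≤ t 0 * D := (ht 0).1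
    have b : t 0 * D ≤ ((hi.getD 0 0 : ℕ) : ℝ) := (ht 0).2
    rw [h0] at a; rw [h0'] at b
    have : t 0 * D = 1 * D := by rw [one_mul]; exact le_antisymm b a
    exact mul_right_cancel₀ hD'.ne' this
  refine ⟨ht0, fun j => ?_⟩
  have a := (ht j.succ).1; have b := (ht j.succ).2
  have c := (hopen j).1; have d := (hopen j).2
  have hsucc : (j.succ : ℕ) = j.val + 1 := rfl
  rw [hsucc] at a b
  rw [ht0]
  constructor
  · have : (0 : ℝ) < ((lo.getD (j.val + 1) 0 : ℕ) : ℝ) := by exact_mod_cast c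
    nlinarith
  · have : ((hi.getD (j.val + 1) 0 : ℕ) : ℝ) < (D : ℝ) := by exact_mod_cast d
    nlinarith

/-- **THE FIRST-ORDER THEOREM (the envelope bound without calculus).** Let the box be `envOK` with summary `(g, e)`. For a
box direction `t` with a critical point `(X + t₆, Y + t₆)` of `aOfS t`, `(X, Y)` in the tube, and a critical point
`(X_c + c₆, Y_c + c₆)` of the CENTRE direction `aOfS c`, `(X_c, Y_c)` in the tube, at `Q`-distance `≤ (dX, dY)`, there is
`v` in the hull with `|growthLogR(t-point) − growthLogR(c-point) − Σ_i (t_i − c_i)·v_i| ≤ e/(SC·Q)`. -/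
theorem critical_value_first_order {D T0 : ℕ} {lo hi : List ℕ} {tb : Tube} {dX dY : ℕ}
    (hok : envOK D T0 lo hi tb = true)
    {g : List MI} {e : ℤ} (hs : envSummary D T0 lo hi tb dX dY = some (g, e))
    {t : Fin 8 → ℝ} (ht : t ∈ box D lo hi) {X Y : ℝ} (hXY : (X, Y) ∈ tube D T0 tb)
    (hc : IsCritical (aOfS t) (X + t 6) (Y + t 6))
    {Xc Yc : ℝ} (hXYc : (Xc, Yc) ∈ tube D T0 tb)
    (hcc : IsCritical (aOfS (centre D lo hi)) (Xc + centre D lo hi 6) (Yc + centre D lo hi 6))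
    (hdX : |X - Xc| * (2 * D * T0) ≤ dX) (hdY : |Y - Yc| * (2 * D * T0) ≤ dY) :
    ∃ v : Fin 8 → ℝ, (∀ i : Fin 8, MI.mem SC (v i) (getI g i)) ∧
      |growthLogR (pR (aOfS t)) (qR (aOfS t)) (X + t 6) (Y + t 6)
          - growthLogR (pR (aOfS (centre D lo hi))) (qR (aOfS (centre D lo hi))) (Xc + centre D lo hi 6)
              (Yc + centre D lo hi 6)
          - ∑ i : Fin 8, (t i - centre D lo hi i) * v i| ≤ (e : ℝ) / (SC * (2 * D * T0)) := by
  obtain ⟨hD, ⟨hT0, hT2⟩, _, _, hle, _⟩ := envOK_spec hok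
  have hle' : ∀ i : Fin 8, lo.getD i 0 ≤ hi.getD i 0 := fun i => (hle i).1
  set c := centre D lo hi with hcdef
  have hcmem : c ∈ box D lo hi := centre_mem hD hle'
  obtain ⟨IH1, IH2, IH3⟩ := envAcc_sound hD hT0 hT2 hle' (tb := tb) vforms hs
  -- the two bridges (x ≠ 0, y ≠ 0 are forms 0 and 1)
  have f0mem : (⟨1, [0,0,0,0,0,0,1,0], 1, 0⟩ : EForm) ∈ vforms := by simp [vforms]
  have f1mem : (⟨1, [0,0,0,0,0,0,1,0], 0, 1⟩ : EForm) ∈ vforms := by simp [vforms]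
  have ex : ∀ (u : Fin 8 → ℝ) (A B : ℝ), formVal ⟨1, [0,0,0,0,0,0,1,0], 1, 0⟩ u A B = A + u 6 := by
    intro u A B; simp [formVal, featVal, coef, Fin.sum_univ_eight]; ring
  have ey : ∀ (u : Fin 8 → ℝ) (A B : ℝ), formVal ⟨1, [0,0,0,0,0,0,1,0], 0, 1⟩ u A B = B + u 6 := by
    intro u A B; simp [formVal, featVal, coef, Fin.sum_univ_eight]; ring
  have hx : X + t 6 ≠ 0 := by rw [← ex t X Y]; exact IH3 _ f0mem ht hXY
  have hy : Y + t 6 ≠ 0 := by rw [← ey t X Y]; exact IH3 _ f1mem ht hXY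
  have hxc : Xc + c 6 ≠ 0 := by rw [← ex c Xc Yc]; exact IH3 _ f0mem hcmem hXYc
  have hyc : Yc + c 6 ≠ 0 := by rw [← ey c Xc Yc]; exact IH3 _ f1mem hcmem hXYc
  have hopen := (openBox_of_envOK hok ht).2
  have hopenc := (openBox_of_envOK hok hcmem).2
  rw [growthLogR_eq_valueV hopen hc hx hy, growthLogR_eq_valueV hopenc hcc hxc hyc]
  -- criticality at the centre kills the linear terms
  obtain ⟨gx0, gy0⟩ := gradXY_eq_zero_of_isCritical hcc hxc hyc
  obtain ⟨v, hv, e1⟩ := IH1 hXY t ht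
  have e2 := IH2 hXY hXYc hdX hdY
  rw [gx0, gy0, mul_zero, mul_zero, add_zero, sub_zero] at e2
  refine ⟨v, hv, ?_⟩
  have : valueV t X Y - valueV c Xc Yc - ∑ i : Fin 8, (t i - c i) * v i
      = valF vforms c X Y - valF vforms c Xc Yc := by
    unfold valueV; linarith
  rw [this]
  exact e2

/-- **The box form.** `envBoxCheck … p q = true` ⇒ under the hypotheses of `critical_value_first_order`,
`|growthLogR(t-point) − growthLogR(c-point)| ≤ p/q`. -/
theorem critical_value_box {D T0 : ℕ} {lo hi : List ℕ} {tb : Tube} {dX dY : ℕ} {p : ℤ} {q : ℕ}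
    (hchk : envBoxCheck D T0 lo hi tb dX dY p q = true)
    {t : Fin 8 → ℝ} (ht : t ∈ box D lo hi) {X Y : ℝ} (hXY : (X, Y) ∈ tube D T0 tb)
    (hc : IsCritical (aOfS t) (X + t 6) (Y + t 6))
    {Xc Yc : ℝ} (hXYc : (Xc, Yc) ∈ tube D T0 tb)
    (hcc : IsCritical (aOfS (centre D lo hi)) (Xc + centre D lo hi 6) (Yc + centre D lo hi 6))
    (hdX : |X - Xc| * (2 * D * T0) ≤ dX) (hdY : |Y - Yc| * (2 * D * T0) ≤ dY) :
    |growthLogR (pR (aOfS t)) (qR (aOfS t)) (X + t 6) (Y + t 6)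
        - growthLogR (pR (aOfS (centre D lo hi))) (qR (aOfS (centre D lo hi))) (Xc + centre D lo hi 6)
            (Yc + centre D lo hi 6)| ≤ (p : ℝ) / q := by
  unfold envBoxCheck at hchk
  simp only [Bool.and_eq_true, decide_eq_true_eq] at hchk
  obtain ⟨⟨hok, hq⟩, hsum⟩ := hchk
  split at hsum
  swap
  · simp at hsum
  rename_i g e hs
  rw [decide_eq_true_eq] at hsum
  obtain ⟨hD, ⟨hT0, hT2⟩, _, _, hle, _⟩ := envOK_spec hok
  have hT0' : 0 < T0 := by omega
  obtain ⟨v, hv, hfo⟩ := critical_value_first_order hok hs ht hXY hc hXYc hcc hdX hdY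
  have hS : (0 : ℝ) < SC := by exact_mod_cast SC_pos
  have hD' : (0 : ℝ) < D := by exact_mod_cast hD
  have hQ : (0 : ℝ) < 2 * D * T0 := by positivity
  have hq' : (0 : ℝ) < q := by exact_mod_cast hq
  -- the slack of the first-order term
  have hterm : ∀ i : Fin 8, |(t i - centre D lo hi i) * v i| ≤
      (((hi.getD i 0 : ℕ) : ℝ) - ((lo.getD i 0 : ℕ) : ℝ)) / (2 * D) * (((max |(getI g i).lo| |(getI g i).hi| : ℤ) : ℝ) / SC) := by
    intro i
    rw [abs_mul]
    refine mul_le_mul (abs_sub_centre_le hD ht i) (abs_le_of_mem (hv i)) (abs_nonneg _) ?_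
    have : ((lo.getD i 0 : ℕ) : ℝ) ≤ ((hi.getD i 0 : ℕ) : ℝ) := by exact_mod_cast (hle i).1
    exact div_nonneg (by linarith) (by positivity)
  set R : ℤ := sum8 fun i => (((hi.getD i 0 : ℕ) : ℤ) - ((lo.getD i 0 : ℕ) : ℤ)) * max |(getI g i).lo| |(getI g i).hi| with hR
  have hslack : |∑ i : Fin 8, (t i - centre D lo hi i) * v i| ≤ (R : ℝ) / (2 * D * SC) := by
    refine (Finset.abs_sum_le_sum_abs _ _).trans ((Finset.sum_le_sum fun i _ => hterm i).trans (le_of_eq ?_))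
    rw [hR, sum8_eq_sum]; push_cast
    rw [Finset.sum_div]
    refine Finset.sum_congr rfl fun i _ => ?_
    field_simp
  have hI : (((e * (2 * D) + R * (2 * D * T0)) * (q : ℤ) : ℤ) : ℝ) ≤ ((p * (2 * D) * (SC : ℤ) * (2 * D * T0) : ℤ) : ℝ) := by
    exact_mod_cast hsum
  push_cast at hI
  have key : (e : ℝ) / (SC * (2 * D * T0)) + (R : ℝ) / (2 * D * SC) ≤ (p : ℝ) / q := by
    rw [div_add_div _ _ (by positivity) (by positivity), div_le_div_iff₀ (by positivity) hq']
    nlinarith [hI]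
  calc |growthLogR (pR (aOfS t)) (qR (aOfS t)) (X + t 6) (Y + t 6)
        - growthLogR (pR (aOfS (centre D lo hi))) (qR (aOfS (centre D lo hi))) (Xc + centre D lo hi 6)
            (Yc + centre D lo hi 6)|
      ≤ |growthLogR (pR (aOfS t)) (qR (aOfS t)) (X + t 6) (Y + t 6)
        - growthLogR (pR (aOfS (centre D lo hi))) (qR (aOfS (centre D lo hi))) (Xc + centre D lo hi 6)
            (Yc + centre D lo hi 6) - ∑ i : Fin 8, (t i - centre D lo hi i) * v i|
          + |∑ i : Fin 8, (t i - centre D lo hi i) * v i| := by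
        set a := growthLogR (pR (aOfS t)) (qR (aOfS t)) (X + t 6) (Y + t 6)
          - growthLogR (pR (aOfS (centre D lo hi))) (qR (aOfS (centre D lo hi))) (Xc + centre D lo hi 6)
            (Yc + centre D lo hi 6)
        set s := ∑ i : Fin 8, (t i - centre D lo hi i) * v i
        have : a = (a - s) + s := by ring
        conv_lhs => rw [this]
        exact abs_add_le _ _
    _ ≤ (e : ℝ) / (SC * (2 * D * T0)) + (R : ℝ) / (2 * D * SC) := add_le_add hfo hslack
    _ ≤ (p : ℝ) / q := key

end Envelope

end Summit.KontsevichZagierPeriods.Zeta5Search.Barrier.ConeGamma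

end
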